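import Summits.AtomisticToContinuum.HydrodynamicLimit.Theorems.CollisionIsometryCLTAdaptedWeightCLTLine

/-!
# Time-local statements of the line `contact-source-duhamel` for the crux `AdaptedWeightCLT`
(stmt-AtomisticToContinuum-14868 = the rev-12 TIME-LOCAL form of the crux, ex stmt-12949; route
`CollisionIsometryCLT`, sub-problem `HydrodynamicLimit`)

Definitions-only support file (`--supports stmt-AtomisticToContinuum-14868`) of the line lead
(`Cruxes/AdaptedWeightCLT/Lines/contact-source-duhamel.lean`, re-cut 2026-08-16 to the rev-12 decl and
re-registered on stmt-14868). It makes the line's STATEMENTS importable so that each registered stub lands in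
its own sorry-free Theorems file with the registered signature verbatim; the OBJECTS (`Cfg, Flows, tpow,
velAfter, tTransport, src, srcCh, pastF, xiF, xiChF, cloud, cd2, PastSq, XiDevSq, XiCorr, DefectSq, Δℓ, …`) are
those of `CollisionIsometryCLTAdaptedWeightCLTLine.lean` (unchanged, imported).

Why a new module and namespace (`…Theorems.ContactSourceDuhamel.TimeLocal`). Rev 12 of the route
(2026-08-16T06:37Z) moved the a-priori tail hypothesis of the crux inside its `∀ t > 0`: the crux is now
`∀ profiles ∃ σ₀ ∀ σ < σ₀ ∀ Φ, H1 → ∀ kernels ∀ t > 0, H2 on [0,t] → C on [0,t]`. The rev-11 statements module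
`CollisionIsometryCLTAdaptedWeightCLTStatements.lean` records `AdaptedWeightCLT ↔ (… DiffuseAt → TailsAt →
CruxTail)` by `Iff.rfl`, which no longer elaborates (lean check rc 1 at `adaptedWeightCLT_iff`), and a
Theorems module cannot have a declaration restated by a prover (append-only), so that module and its
importers are dead for the rev-12 item. This module supersedes it: the five predicates that do not mention
H2 (`NiceProfiles`, `AdmissibleKernel`, `DuhamelIdentity`, `FlowDictionary`, `DiffuseAt`) are re-homed here
byte-for-byte (same bodies, new namespace — deliberately, so that the proved stubs `stub_duhamel`,
`stub_flowDictionary` re-land by changing one import line), `CDAlongAt` is re-typed with the cubic-unisolvent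
rank-3 probe set `cd3x` (the standing disprover's `stub-misstated: stub_pastDamping`, certified by
`Theorems/AdaptedWeightCLT/Negative/CubicProbeDeficiency.lean`: the six `dirV` probes of `cd3` lie on
`xyz = 0` and cannot control the heat-flux PAST; ten directions do, `tpow_three_polarization`), and the
H2-consuming statements are sliced per horizon: `TailsOn … t` (= the crux's per-`t` hypothesis verbatim),
`PastSmallOn`, `CrossNullOn`, `SourceContractionOn`, `ConclOn … t` (the crux's conclusion on `[0,t]`, its
`let ρb mb ub D q` telescope verbatim) and `CruxTailT` (the rev-12 tail verbatim from `∀ (γ C : ℝ) (φ …)`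
on). `adaptedWeightCLT_iff` is `Iff.rfl` again: the crux IS `∀ nice profiles ∃ σ₀ ∀ σ < σ₀ ∀ Φ,
DiffuseAt → CruxTailT`, and `cruxTailT_of_conclOn` is the bookkeeping that feeds it from per-horizon slices.
Nothing is asserted: every `def … : Prop` is a predicate, never a hypothesis taken as a fact.
-/

namespace Summit.AtomisticToContinuum.HydrodynamicLimit.Theorems.ContactSourceDuhamel.TimeLocal

open scoped BigOperators Topology Classical MeasureTheory ENNReal InnerProductSpace
open Filter Set MeasureTheory

noncomputable section

/-! ## The repaired rank-3 column-depolarisation functional -/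

/-- The ten CUBIC-UNISOLVENT probe impulses `e_p` (`p = 0,1,2`), `e_p + e_q`, `e_p − e_q` (`p < q`),
`e₀ + e₁ + e₂` (unnormalised, exactly the directions of `AdaptedWeightCLTNegative.tpow_three_polarization`:
every cube `y^{⊗3}` is a combination of their cubes with coefficients `≤ 3‖y‖³`, so by linearity of the
incoherent transport the cubic clouds of these ten impulses control `𝒯(δ_k y^{⊗3})` for every `y`). -/
def udir : Fin 10 → V3 :=
  ![baseV 0, baseV 1, baseV 2, baseV 0 + baseV 1, baseV 0 + baseV 2, baseV 1 + baseV 2,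
    baseV 0 - baseV 1, baseV 0 - baseV 2, baseV 1 - baseV 2, baseV 0 + baseV 1 + baseV 2]

/-- Rank-3 COLUMN DEPOLARISATION functional over the window `[0, Δ]`, cubic-unisolvent form: the mean
over injection sites `k` of the summed squared norms of the cubic clouds of the ten probe impulses `udir`
(spin-1 suppression target; replaces the six-probe `cd3` of the rev-11 line, which
`AdaptedWeightCLTNegative.cubic_probe_deficiency` shows cannot control the heat-flux PAST). -/
def cd3x (σ : ℝ) (N : ℕ) (y : Cfg N) (Δ : ℝ) : ℝ :=
  ((N + 1 : ℕ) : ℝ)⁻¹ * ∑ k : Fin (N + 1), ∑ p : Fin 10,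
    normSqT (cloud 3 σ N y (steps σ N y Δ) k (udir p))

/-! ## Profiles, kernels, the two exact inputs, H1 -/

/-- Continuous, positive profiles (the crux's hypotheses on `a₀, θ₀, u₀`). -/
def NiceProfiles (a₀ θ₀ : T3 → ℝ) (u₀ : T3 → V3) : Prop :=
  Continuous a₀ ∧ Continuous θ₀ ∧ Continuous u₀ ∧ (∀ x, 0 < a₀ x) ∧ (∀ x, 0 < θ₀ x)

/-- Admissible kernel families (verbatim the crux's kernel hypothesis at `(γ, C, φ)`). -/
def AdmissibleKernel (γ C : ℝ) (φ : ℕ → T3 → ℝ) : Prop :=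
  (∀ N, Literature.Analysis.FunctionSpaces.Torus.IsSmooth (φ N)) ∧ (∀ N y, 0 ≤ φ N y) ∧ (∀ N, ∫ y, φ N y = 1) ∧ (∀ (N : ℕ) y, ((N : ℝ) + 1) ^ (-γ) ≤ Literature.Analysis.FluidPDE.Torus.euclidDist y 0 → φ N y = 0) ∧ (∀ (N : ℕ) y, φ N y ≤ C * ((N : ℝ) + 1) ^ (3 * γ)) ∧ (∀ (N : ℕ) y, ‖Literature.Analysis.FunctionSpaces.Torus.gradient (φ N) y‖ ≤ C * ((N : ℝ) + 1) ^ (4 * γ))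

/-- **VARIATION OF CONSTANTS along the collision sequence** (exact algebra of the typed fold, all
ranks `r ≥ 1`; at `r = 0` the binomial split `1 = 1 + 1` is false, at `r = 1` there are no sources —
momentum conservation): for every `N`, window start `y`, shift `u` and number of fold steps `m`, the family of
rank-`r` powers of the shifted transported velocities equals the incoherent transport of the initial
powers plus the sum over the steps `l < m` of the sources of step `l` transported from step `l+1` on:
`Y^{(m)} = 𝒯_{0→m} Y^{(0)} + Σ_{l<m} 𝒯_{l+1→m} src_l`. -/
def DuhamelIdentity (σ : ℝ) : Prop :=
  ∀ (r N : ℕ) (y : Cfg N) (u : V3) (m : ℕ), 0 < r →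
    (fun i => tpow r (velAfter σ N y m i - u)) =
      tTransport r σ N y 0 m (fun k => tpow r ((y k).2 - u)) +
        ∑ l ∈ Finset.range m, tTransport r σ N y (l + 1) (m - (l + 1)) (src r σ N y u l)

/-- **FLOW DICTIONARY** (the fold IS the flow, almost surely and uniformly in time): for every `N`
and every hard-sphere flow of `N+1` spheres of diameter `hsDiameter σ N` on `𝕋³`, for Liouville-a.e.
`z`, for ALL `s` and `Δ ≥ 0`, the velocities of `Φ_{s+Δ} z` are the crux's transfer over `[0, Δ]`
restarted at `Φ_s z` applied to the velocities of `Φ_s z` (the uniform-in-`s` form of the route's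
support item `TransferRepresentsFlow`, stmt-12952). -/
def FlowDictionary (σ : ℝ) : Prop :=
  ∀ (N : ℕ) (Φ : Flow σ N),
    ∀ᵐ z ∂(Literature.Analysis.FluidPDE.liouville (Literature.Analysis.FluidPDE.Torus.geometry (Fin 3))
      (N + 1) (Literature.MathematicalPhysics.KineticTheory.hsDiameter σ N)),
      ∀ s Δ : ℝ, 0 ≤ Δ →
        (fun i => (Φ.flow (s + Δ) z i).2) = velAfter σ N (Φ.flow s z) (steps σ N (Φ.flow s z) Δ)

/-- H1 at `(σ, profiles, Φ)`: verbatim the crux's first hypothesis (= the conclusion of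
`DiffuseBackwardInfluence`), its `let M; let ipr` written as this file's `iprF`. -/
def DiffuseAt (σ : ℝ) (a₀ θ₀ : T3 → ℝ) (u₀ : T3 → V3) (Φ : Flows σ) : Prop :=
  ∀ Δ : ℕ → ℝ, (∀ N, 0 < Δ N) → Tendsto Δ atTop (𝓝 0) → Tendsto (fun N : ℕ => Δ N * ((N + 1 : ℕ) : ℝ) ^ ((1 : ℝ) / 3)) atTop atTop → ∀ t : ℝ, 0 < t → Tendsto (fun N : ℕ => ∫⁻ z, ENNReal.ofReal (iprF σ N ((Φ N).flow (t - Δ N) z) (Δ N)) ∂(Literature.MathematicalPhysics.KineticTheory.localGibbsLaw σ a₀ u₀ θ₀ N (Φ N))) atTop (𝓝 0)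

/-- COLUMN DEPOLARISATION ALONG THE LINE WINDOW at `(σ, profiles, Φ)` (repaired rank-3 half): for
every `t > 0` the local-Gibbs mean of `cd2 + cd3x` of the incoherent transport over `[t − Δℓ_N, t]` tends
to `0` (rank 2: impulse-cloud stresses reach `|a|²𝟙/3` along the six `dirV`; rank 3: the cubic clouds of
the ten unisolvent probes `udir` vanish). -/
def CDAlongAt (σ : ℝ) (a₀ θ₀ : T3 → ℝ) (u₀ : T3 → V3) (Φ : Flows σ) : Prop :=
  ∀ t : ℝ, 0 < t → Tendsto (fun N : ℕ => ∫⁻ z, ENNReal.ofReal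
      (cd2 σ N ((Φ N).flow (t - Δℓ N) z) (Δℓ N) + cd3x σ N ((Φ N).flow (t - Δℓ N) z) (Δℓ N))
    ∂(Literature.MathematicalPhysics.KineticTheory.localGibbsLaw σ a₀ u₀ θ₀ N (Φ N))) atTop (𝓝 0)

/-! ## Per-horizon statements (H2 and everything consuming it live on `[0, t]`) -/

/-- H2 on the horizon `[0, t]` at `(σ, profiles, Φ)`: verbatim the per-`t` hypothesis of the rev-12 crux
(= component (i) of `AprioriBoundsPreShock` at `t`; the rev-11 global `TailsAt` is `∀ t > 0, TailsOn … t`). -/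
def TailsOn (σ : ℝ) (a₀ θ₀ : T3 → ℝ) (u₀ : T3 → V3) (Φ : Flows σ) (t : ℝ) : Prop :=
  ∃ lam Cexp : ℝ, 0 < lam ∧ Tendsto (fun N : ℕ => Literature.MathematicalPhysics.KineticTheory.localGibbsLaw σ a₀ u₀ θ₀ N (Φ N) {z | Cexp < ∫ s in Icc 0 t, ∫ y, Real.exp (lam * ‖y.2‖ ^ 2) ∂(Literature.Analysis.FluidPDE.empiricalMeasure ((Φ N).flow s z))}) atTop (𝓝 0)

/-- PAST DAMPED on the horizon `[0, t]`: for every admissible kernel family and `δ > 0`,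
`P(∫₀ᵗ ∫ₓ Σ_tests PAST² > δ) → 0` (the per-`t` slice of the rev-11 `PastSmallAt`). -/
def PastSmallOn (σ : ℝ) (a₀ θ₀ : T3 → ℝ) (u₀ : T3 → V3) (Φ : Flows σ) (t : ℝ) : Prop :=
  ∀ (γ C : ℝ) (φ : ℕ → T3 → ℝ), 0 < γ → γ ≤ 1 / 15 → AdmissibleKernel γ C φ →
    ∀ δ : ℝ, 0 < δ →
      Tendsto (fun N : ℕ => Literature.MathematicalPhysics.KineticTheory.localGibbsLaw σ a₀ u₀ θ₀ N (Φ N)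
        {z | δ < ∫ s in Icc 0 t, ∫ x, PastSq σ N (Φ N) φ s z x}) atTop (𝓝 0)

/-- CONTACT CROSS NULL on the horizon `[0, t]`: for every admissible kernel family and `δ > 0`,
`P(∫₀ᵗ ∫ₓ Σ_tests (Ξ − Ξ^ch)² > δ) → 0` (the per-`t` slice of the rev-11 `CrossNullAt`). -/
def CrossNullOn (σ : ℝ) (a₀ θ₀ : T3 → ℝ) (u₀ : T3 → V3) (Φ : Flows σ) (t : ℝ) : Prop :=
  ∀ (γ C : ℝ) (φ : ℕ → T3 → ℝ), 0 < γ → γ ≤ 1 / 15 → AdmissibleKernel γ C φ →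
    ∀ δ : ℝ, 0 < δ →
      Tendsto (fun N : ℕ => Literature.MathematicalPhysics.KineticTheory.localGibbsLaw σ a₀ u₀ θ₀ N (Φ N)
        {z | δ < ∫ s in Icc 0 t, ∫ x, XiDevSq σ N (Φ N) φ s z x}) atTop (𝓝 0)

/-- SOURCE CONTRACTION on the horizon `[0, t]`: for every admissible kernel family there is `κ < 1`
such that for every `δ > 0`, `P(∫₀ᵗ ∫ₓ Σ_tests Blk · Ξ^ch > κ ∫₀ᵗ ∫ₓ (|D|² + |q|²) + δ) → 0` (the per-`t`
slice of the rev-11 `SourceContractionAt`). -/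
def SourceContractionOn (σ : ℝ) (a₀ θ₀ : T3 → ℝ) (u₀ : T3 → V3) (Φ : Flows σ) (t : ℝ) : Prop :=
  ∀ (γ C : ℝ) (φ : ℕ → T3 → ℝ), 0 < γ → γ ≤ 1 / 15 → AdmissibleKernel γ C φ →
    ∃ κ : ℝ, κ < 1 ∧ ∀ δ : ℝ, 0 < δ →
      Tendsto (fun N : ℕ => Literature.MathematicalPhysics.KineticTheory.localGibbsLaw σ a₀ u₀ θ₀ N (Φ N)
        {z | κ * (∫ s in Icc 0 t, ∫ x, DefectSq σ N (Φ N) φ s z x) + δ <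
          ∫ s in Icc 0 t, ∫ x, XiCorr σ N (Φ N) φ s z x}) atTop (𝓝 0)

/-- The crux's CONCLUSION on the horizon `[0, t]` at `(σ, profiles, Φ)`: for every admissible kernel
family and `δ > 0`, `P(∫₀ᵗ ∫ₓ Σ_{jk} D_{jk}² + |q|² > δ) → 0`, the block fields `ρb, mb, ub, D, q` being the
crux's own `let`s verbatim (so that the crux's event is this one by ζ-reduction). -/
def ConclOn (σ : ℝ) (a₀ θ₀ : T3 → ℝ) (u₀ : T3 → V3) (Φ : Flows σ) (t : ℝ) : Prop :=
  ∀ (γ C : ℝ) (φ : ℕ → (UnitAddTorus (Fin 3)) → ℝ), 0 < γ → γ ≤ 1 / 15 → AdmissibleKernel γ C φ → let ρb := fun (N : ℕ) (s : ℝ) z (x : UnitAddTorus (Fin 3)) => Literature.MathematicalPhysics.KineticTheory.empiricalDensityField ((Φ N).flow s z) (fun y => φ N (y - x)); let mb := fun (N : ℕ) (s : ℝ) z (x : UnitAddTorus (Fin 3)) => Literature.MathematicalPhysics.KineticTheory.empiricalMomentumField ((Φ N).flow s z) (fun y => φ N (y - x)); let ub := fun (N : ℕ) (s : ℝ) z (x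 : UnitAddTorus (Fin 3)) => (ρb N s z x)⁻¹ • mb N s z x; let D := fun (N : ℕ) (s : ℝ) z (x : UnitAddTorus (Fin 3)) (j k : Fin 3) => (∫ y, φ N (y.1 - x) * ((y.2 j - ub N s z x j) * (y.2 k - ub N s z x k)) ∂(Literature.Analysis.FluidPDE.empiricalMeasure ((Φ N).flow s z))) - (if j = k then (∑ l : Fin 3, ∫ y, φ N (y.1 - x) * (y.2 l - ub N s z x l) ^ 2 ∂(Literature.Analysis.FluidPDE.empiricalMeasure ((Φ N).flow s z))) / 3 else 0); let q := fun (N : ℕ) (s : ℝ) z (x : UnitAddTorus (Fin 3)) => ∫ y, (φ N (y.1 - x) * ‖y.2 - ub N s z x‖ ^ 2 / 2) • (y.2 - ub N s z x) ∂(Literature.Analysis.FluidPDE.empiricalMeasure ((Φ N).flow s z)); ∀ δ : ℝ, 0 < δ → Tendsto (fun N : ℕ => Literature.MathematicalPhysics.KineticTheory.localGibbsLaw σ a₀ u₀ θ₀ N (Φ N) {z | δ < ∫ s in Icc 0 t, ∫ x, ((∑ j, ∑ k, D N s z x j k ^ 2) + ‖q N s z x‖ ^ 2)}) atTop (𝓝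 0)

/-- The TAIL of the rev-12 (time-local) crux at `(σ, profiles, Φ)`: verbatim its text from
`∀ (γ C : ℝ) (φ …)` on — kernels, the `let ρb mb ub D q` telescope, then `∀ t > 0`, H2 on `[0, t]`, and
the conclusion on `[0, t]`. -/
def CruxTailT (σ : ℝ) (a₀ θ₀ : T3 → ℝ) (u₀ : T3 → V3) (Φ : Flows σ) : Prop :=
  ∀ (γ C : ℝ) (φ : ℕ → (UnitAddTorus (Fin 3)) → ℝ), 0 < γ → γ ≤ 1 / 15 → ((∀ N, Literature.Analysis.FunctionSpaces.Torus.IsSmooth (φ N)) ∧ (∀ N y, 0 ≤ φ N y) ∧ (∀ N, ∫ y, φ N y = 1) ∧ (∀ (N : ℕ) y, ((N : ℝ) + 1) ^ (-γ) ≤ Literature.Analysis.FluidPDE.Torus.euclidDist y 0 → φ N y = 0) ∧ (∀ (N : ℕ) y, φ N y ≤ C * ((N : ℝ) + 1) ^ (3 * γ)) ∧ (∀ (N : ℕ) y, ‖Literature.Analysis.FunctionSpaces.Torus.gradient (φ N) y‖ ≤ C * ((N : ℝ) + 1) ^ (4 * γ))) → let ρb := fun (N : ℕ) (s : ℝ)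 z (x : UnitAddTorus (Fin 3)) => Literature.MathematicalPhysics.KineticTheory.empiricalDensityField ((Φ N).flow s z) (fun y => φ N (y - x)); let mb := fun (N : ℕ) (s : ℝ) z (x : UnitAddTorus (Fin 3)) => Literature.MathematicalPhysics.KineticTheory.empiricalMomentumField ((Φ N).flow s z) (fun y => φ N (y - x)); let ub := fun (N : ℕ) (s : ℝ) z (x : UnitAddTorus (Fin 3)) => (ρb N s z x)⁻¹ • mb N s z x; let D := fun (N : ℕ) (s : ℝ) z (x : UnitAddTorus (Fin 3)) (j k : Fin 3) => (∫ y, φ N (y.1 - x) * ((y.2 j - ub N s z x j) * (y.2 k - ub N s z x k)) ∂(Literature.Analysis.FluidPDE.empiricalMeasure ((Φ N).flow s z))) - (if j = k then (∑ l : Fin 3, ∫ y, φ N (y.1 - x) * (y.2 l - ub N s z x l) ^ 2 ∂(Literature.Analysis.FluidPDE.empiricalMeasure ((Φ N).flow s z))) / 3 else 0); let q := fun (N : ℕ) (s : ℝ) z (x : UnitAddTorus (Fin 3)) => ∫ y, (φ N (y.1 - x) * ‖y.2 - ub N s z x‖ ^ 2 / 2) • (y.2 - ub N s z x) ∂(Literature.Analysis.FluidPDE.empiricalMeasure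 ((Φ N).flow s z)); ∀ t : ℝ, 0 < t → (∃ lam Cexp : ℝ, 0 < lam ∧ Tendsto (fun N : ℕ => Literature.MathematicalPhysics.KineticTheory.localGibbsLaw σ a₀ u₀ θ₀ N (Φ N) {z | Cexp < ∫ s in Icc 0 t, ∫ y, Real.exp (lam * ‖y.2‖ ^ 2) ∂(Literature.Analysis.FluidPDE.empiricalMeasure ((Φ N).flow s z))}) atTop (𝓝 0)) → ∀ δ : ℝ, 0 < δ → Tendsto (fun N : ℕ => Literature.MathematicalPhysics.KineticTheory.localGibbsLaw σ a₀ u₀ θ₀ N (Φ N) {z | δ < ∫ s in Icc 0 t, ∫ x, ((∑ j, ∑ k, D N s z x j k ^ 2) + ‖q N s z x‖ ^ 2)}) atTop (𝓝 0)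

/-! ## Bookkeeping between the slices and the crux -/

/-- The time-local tail of the crux from its per-horizon slices: if for every `t > 0` the tail bound on
`[0, t]` gives the conclusion on `[0, t]`, then `CruxTailT` holds (pure bookkeeping: the kernel binders
commute with `t`, and the crux's `let` telescope is `ConclOn`'s by ζ-reduction). -/
theorem cruxTailT_of_conclOn {σ : ℝ} {a₀ θ₀ : T3 → ℝ} {u₀ : T3 → V3} {Φ : Flows σ}
    (h : ∀ t : ℝ, 0 < t → TailsOn σ a₀ θ₀ u₀ Φ t → ConclOn σ a₀ θ₀ u₀ Φ t) :
    CruxTailT σ a₀ θ₀ u₀ Φ := by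
  intro γ C φ hγ hγ' hadm ρb mb ub D q t ht hT δ hδ
  exact h t ht hT γ C φ hγ hγ' hadm δ hδ

/-- Conversely, the time-local tail gives every per-horizon slice (so the two forms are equivalent). -/
theorem conclOn_of_cruxTailT {σ : ℝ} {a₀ θ₀ : T3 → ℝ} {u₀ : T3 → V3} {Φ : Flows σ}
    (h : CruxTailT σ a₀ θ₀ u₀ Φ) {t : ℝ} (ht : 0 < t) (hT : TailsOn σ a₀ θ₀ u₀ Φ t) :
    ConclOn σ a₀ θ₀ u₀ Φ t := by
  intro γ C φ hγ hγ' hadm ρb mb ub D q δ hδ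
  exact h γ C φ hγ hγ' hadm t ht hT δ hδ

/-! ## The crux in this vocabulary -/

/-- Sanity check of the verbatim copies: the (rev-12, time-local) crux `CollisionIsometryCLT.AdaptedWeightCLT`
is, definitionally, `∀ nice profiles ∃ σ₀ ∀ σ < σ₀ ∀ Φ, DiffuseAt → CruxTailT` (its `let M; let ipr`
ζδ-reduce to `transferSteps … (steps …)` / `iprF`, its tail is `CruxTailT` verbatim). -/
theorem adaptedWeightCLT_iff :
    Summit.AtomisticToContinuum.HydrodynamicLimit.Theses.CollisionIsometryCLT.AdaptedWeightCLT ↔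
      ∀ (a₀ θ₀ : T3 → ℝ) (u₀ : T3 → V3), Continuous a₀ → Continuous θ₀ → Continuous u₀ →
        (∀ x, 0 < a₀ x) → (∀ x, 0 < θ₀ x) → ∃ σ₀ : ℝ, 0 < σ₀ ∧ ∀ σ : ℝ, 0 < σ → σ < σ₀ →
          ∀ Φ : Flows σ, DiffuseAt σ a₀ θ₀ u₀ Φ → CruxTailT σ a₀ θ₀ u₀ Φ :=
  Iff.rfl

end

end Summit.AtomisticToContinuum.HydrodynamicLimit.Theorems.ContactSourceDuhamel.TimeLocal
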